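import Mathlib
import HarnessLib
import Literature.NumberTheory.LFunctions.ZetaScrew
import Summits.RiemannHypothesis.RiemannHypothesis.Theorems.IntegerScrewDefs
import Summits.RiemannHypothesis.RiemannHypothesis.Theorems.IntegerScrewNestedSylvester

/-!
# SCREW column, prover lane — the structured-SOS ("manifest wave") certificate TEMPLATE of the
engine-B census (sos-cert/v1 / sos-dualcert/v1), TYPED as a Lean proposition `P_M(t_min, T)`.

RH-FREE / RH-EQUIVALENT LABELS (ladder §5 rule 4), item by item:
* `ManifestCert n tmin T`            — RH-FREE (a finite certificate FORMAT; one instance per cell M@T,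
                                        M = n+1; decided in practice by LP + exact rounding (feasible)
                                        or by a dual polynomial (infeasible)).
* `WaveAtomPSD`, `StrictDDPosDef`, `ManifestCertSound`, `ManifestCertNested`,
  `UnstructuredCertIffPosDef`        — RH-FREE, PROVABLE NOW (linear algebra; no zeta input).
* `manifestCert_mono`, `manifestFamily_imp_rh` — RH-FREE, PROVED below (the second modulo the
                                        soundness item, from the tree's `riemannHypothesis_iff_screwMatrix_posDef`).
* `ManifestFamily tmin` (∀ M ∃ T)    — RH-EQUIVALENT (→ RH by soundness + the tree; ← RH is the crux
                                        `TailDDOfRH`).  NOT bookable as progress toward RH.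
* `TailDDOfRH`                       — an RH-CONSEQUENCE to be proved (explicit formula truncated at an
                                        M-dependent height is eventually diagonally dominant).
* `NyquistFloor`                     — RH-FREE conjecture slot (a LOWER bound on the certificate height:
                                        an obstruction, true or false independently of RH).
* `LinearithmicCeiling`              — RH-CONDITIONAL law slot (the census growth law as an ∀M sentence
                                        presupposes `ManifestFamily`, i.e. RH).
* `Rung n lo hi`, `CensusBrackets…`  — RH-FREE finite DATA statements (the certified T_DD brackets of
                                        HOME/sos/census/engine-B/ddcone/), kernel import pending.
* Batch 3 (gen16): `DualCert`, `dualCert_sound`, `lapDual_sound` — RH-FREE, PROVED (the sos-dualcert/v1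
                                        soundness direction: a `DD*` matrix pairing negatively with `S_M`
                                        and non-negatively with the atoms refutes a manifest certificate);
  `TopBlockDDStar` (PROVED, `decide +kernel`), `TopBlockPairingNeg`, `TopBlockWavePos`,
  `TopBlockD16Works` (= the typed FIRST LEMMA of the `NyquistFloor` line, OPEN, RH-FREE, PRIME-FREE),
  `NyquistFloorFrom`, `SmallRangeFloor` and the PROVED reductions
  `TopBlockD16Works → NyquistFloorFrom 31 0.3116…`, `… ∧ SmallRangeFloor 31 c' → NyquistFloor`;
  Batch 3C/3D: `FloorAtEight` and the EXACT `M = 8` dual of record `y8K` (census cell M008-T20-dd;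
  `y8_inDDDual` PROVED by `decide +kernel`), `Dual8PairingNeg`, `Dual8WavePos` (OPEN, finite) and the
  PROVED bottom line `nyquistFloor_of_D16_and_dual8 : TopBlockD16Works → Dual8PairingNeg →
  Dual8WavePos 20 → NyquistFloor`;
  Batch 3E: `dual8PairingNeg_holds : Dual8PairingNeg` PROVED IN THE KERNEL (validated fixed-point
  enclosures of the 28 entries of `S_8` via `IntegerScrewRungCertSound` + a two-sided bound on
  `ζ(2,¼)`, `decide +kernel`, standard axioms), hence `nyquistFloor_of_D16_and_wave8 :
  TopBlockD16Works → Dual8WavePos 20 → NyquistFloor`;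
  Batch 3F: `dual8WavePos_holds : Dual8WavePos 20` PROVED IN THE KERNEL (a second-order adaptive
  interval certificate: `Q = t²⟨A_t,Y⟩ ≥ 0` on `[0, 20]` from 147 cells `[a, a+h]` with point
  enclosures of `Q(a), Q′(a)` (7 `FI.cosSin` calls each), Lipschitz-inflated enclosures of `Q″` over
  the cell, the Taylor minorant `Q(a) + Q′(a)τ + ½(inf Q″)τ²` checked at `0`, `h` and the vertex, and
  convexity `Q″ ≥ 0` on `[0, 20/1024]`; `decide +kernel` in three segments, standard axioms, file
  checks in ≈ 90 s), hence `floorAtEight_20 : FloorAtEight 20` and THE FINAL FORM OF THE BOTTOM LINE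
  `nyquistFloor_of_D16' : TopBlockD16Works → NyquistFloor` — the `NyquistFloor` line rests on ONE
  typed, RH-free, prime-free statement about D16 (v1.5 also: ref1 g7 s-n1, `CensusBracketsRefPassed` += 48/56/64).
Nothing in this file bears on the truth of RH.  Scratch file of the sos-theory seat (gen15–gen16, v1.5);
not filed.

Source of the format: HOME/sos/census/engine-B/README.md l.4–7, 17–19 and ddcone/README.md §0, §2
(rh-explicit-sos-eng-2 gen1–gen4): `S_M = GᵀG + R`, rows of `G` = `√w_j/t_j·(1 − cos(t_j log m))_m`,
`√w_j/t_j·(sin(t_j log m))_m` and one all-ones row `√w_J·1`, `R` STRICTLY diagonally dominant; i.e.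
`S_M ∈ cone{A(t) : t_min ≤ t ≤ T} + cone{11ᵀ} + DD`, `A(t) = Re(v_t v_t^*)/t²`, `v_t = (1 − m^{it})_{m=2..M}`.
Under RH the explicit formula (Suzuki2023 Thm 1.1(2), tree `Suzuki2023_thm11_series_holds`) is the
`T = ∞` member with atoms at the ordinates `γ` and weights exactly `2`.
FILE LAYOUT (v1.5 of HOME/sos/lean/ScrewManifestCert.lean, sha256 905d43e0…1bc63331, cut for the
400-line Theorems cap; every declaration byte-identical, docstrings added where the gate requires
them; one namespace `…Theorems.IntegerScrew.Manifest` throughout):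
1. `ScrewManifestCertDefs` — objects, `ManifestCert`, `NyquistFloor`, the RH-free soundness proofs;
2. `ScrewManifestCertDual` — nestedness, the unstructured direction, dual certificates, Laplacian
   duals;
3. `ScrewManifestCertTopBlock` — the design `D16`, `(DD*)` in the kernel, `TopBlockPairingNeg`,
   `TopBlockWavePos`, the eventual floor from a top-block dual;
4. `ScrewManifestCertResidual` — the floor from a top-block dual, `TopBlockD16Works`, the residual
   range is one cell, the `M = 8` dual `y8K`, the bound on `ζ(2,¼)` and the checker `dual8Check`;
5. `ScrewManifestCertDual8` — `Dual8PairingNeg` proved; `Q, Q′, Q″` and the analytic glue;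
6. `ScrewManifestCertWaveChecker` — the interval checker and its soundness lemmas;
7. `ScrewManifestCert` — `runCells_sound`, certificate data, kernel computation,
   `dual8WavePos_holds`, `nyquistFloor_of_D16'`, and the RH glue (`manifestFamily_imp_rh`: the
   only declarations that import `IntegerScrewPivotCriterion`; files 1–6 do not import
   `Theses.IntegerScrew`).
-/

set_option linter.dupNamespace false
set_option autoImplicit false

namespace Summit.RiemannHypothesis.RiemannHypothesis.Theorems.IntegerScrew.Manifest

open Literature.NumberTheory.LFunctions Matrix

/-- The node `log m`, `m = i + 2`, of the `n × n` screw matrix `screwMatrix n = S_{n+1}`. -/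
noncomputable def node (n : ℕ) (i : Fin n) : ℝ := Real.log (((i : ℕ) + 2 : ℕ) : ℝ)

/-- RH-FREE. The WAVE ATOM of frequency `t` on the nodes:
`A_t(i,j) = Re[(1 − m^{it})(1 − m'^{−it})]/t² = (1 − cos(t log m) − cos(t log m') + cos(t(log m − log m')))/t²`.
It is `t⁻²·(c cᵀ + s sᵀ)` with `c = (1 − cos(t log m))_m`, `s = (sin(t log m))_m`, hence PSD for `t ≠ 0`. -/
noncomputable def waveAtom (n : ℕ) (t : ℝ) : Matrix (Fin n) (Fin n) ℝ :=
  Matrix.of fun i j =>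
    (1 - Real.cos (t * node n i) - Real.cos (t * node n j)
      + Real.cos (t * (node n i - node n j))) / t ^ 2

/-- The all-ones atom `J = 11ᵀ` (PSD, rank one). -/
def onesMat (n : ℕ) : Matrix (Fin n) (Fin n) ℝ := Matrix.of fun _ _ => 1

/-- STRICT diagonal dominance by rows (real matrices): `Σ_{j ≠ i} |R i j| < R i i` for every row. -/
def IsStrictDiagDominant {n : ℕ} (R : Matrix (Fin n) (Fin n) ℝ) : Prop :=
  ∀ i, ∑ j ∈ Finset.univ.erase i, |R i j| < R i i

/-- The REMAINDER of a wave decomposition with `K` atoms `(t_k, w_k)` and all-ones weight `wJ`: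
`R = S_{n+1} − Σ_k w_k A_{t_k} − wJ·J`. -/
noncomputable def remainder (n K : ℕ) (t w : Fin K → ℝ) (wJ : ℝ) : Matrix (Fin n) (Fin n) ℝ :=
  screwMatrix n - (∑ k, w k • waveAtom n (t k)) - wJ • onesMat n

/-- RH-FREE (certificate FORMAT sos-cert/v1, typed).  `P_M(t_min, T)` with `M = n + 1`:
the screw matrix `S_M` admits a MANIFEST certificate with wave atoms of frequencies in `[t_min, T]`
(all positive), nonnegative weights, a nonnegative all-ones weight, and a STRICTLY diagonally dominant
remainder.  One instance per census cell `M@T` (dictionary `t ∈ [0.1, T]` ⇒ `t_min = 1/10`). -/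
def ManifestCert (n : ℕ) (tmin T : ℝ) : Prop :=
  ∃ (K : ℕ) (t w : Fin K → ℝ) (wJ : ℝ),
    (∀ k, tmin ≤ t k ∧ t k ≤ T ∧ 0 < t k ∧ 0 ≤ w k) ∧ 0 ≤ wJ ∧
      IsStrictDiagDominant (remainder n K t w wJ)

/-- RH-FREE, PROVED: monotonicity of the format in the frequency window. -/
theorem manifestCert_mono {n : ℕ} {tmin tmin' T T' : ℝ} (htmin : tmin' ≤ tmin) (hT : T ≤ T')
    (h : ManifestCert n tmin T) : ManifestCert n tmin' T' := by
  obtain ⟨K, t, w, wJ, hk, hwJ, hR⟩ := h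
  refine ⟨K, t, w, wJ, fun k => ?_, hwJ, hR⟩
  obtain ⟨h1, h2, h3, h4⟩ := hk k
  exact ⟨le_trans htmin h1, le_trans h2 hT, h3, h4⟩

/-- RH-FREE, PROVED below (`waveAtomPSD_proof`): every wave atom is positive semidefinite
(`A_t = t⁻²(c cᵀ + s sᵀ)`, `(1 − cos a)(1 − cos b) + sin a sin b = 1 − cos a − cos b + cos(a − b)`;
at `t = 0` Lean's `x/0 = 0` makes `A_0 = 0`, also PSD). -/
def WaveAtomPSD : Prop := ∀ (n : ℕ) (t : ℝ), (waveAtom n t).PosSemidef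

/-- RH-FREE, PROVED below (`strictDDPosDef_proof`; `xᵀRx ≥ Σ_i x_i²(R_ii − Σ_{j≠i}|R_ij|)`):
a symmetric (= Hermitian over `ℝ`) strictly diagonally dominant real matrix is positive definite. -/
def StrictDDPosDef : Prop :=
  ∀ (n : ℕ) (R : Matrix (Fin n) (Fin n) ℝ), R.IsHermitian → IsStrictDiagDominant R → R.PosDef

/-- RH-FREE, PROVED below (`manifestCertSound_proof`): SOUNDNESS of the format — a manifest
certificate of `S_{n+1}` makes it positive definite (`S = R + (Σ w_k A_{t_k} + wJ·J)`, PD + PSD = PD;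
the remainder is Hermitian because `S` (tree `screwMatrix_isHermitian`) and the PSD part are). -/
def ManifestCertSound : Prop := ∀ (n : ℕ) (tmin T : ℝ), ManifestCert n tmin T → (screwMatrix n).PosDef

/-- RH-FREE, provable now (support): NESTEDNESS — a certificate of `S_{n+1}` restricts to one of
`S_{n'+1}`, `n' ≤ n` (principal submatrix of the remainder is strictly DD; atoms restrict to atoms). -/
def ManifestCertNested : Prop :=
  ∀ (n n' : ℕ) (tmin T : ℝ), n' ≤ n → ManifestCert n tmin T → ManifestCert n' tmin T

/-- RH-FREE, provable now — the TAUTOLOGY HALF of the referee test: WITHOUT the wave structure the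
format is positivity re-indexed.  `∃ G, S − GᵀG strictly DD` ↔ `S ≻ 0` (← : Cholesky of `S − εI`,
remainder `εI`; → : `StrictDDPosDef`).  So the content of the census lies in the BAND LIMIT `T`. -/
def UnstructuredCertIffPosDef : Prop :=
  ∀ (n : ℕ), (∃ (K : ℕ) (G : Matrix (Fin K) (Fin n) ℝ),
      IsStrictDiagDominant (screwMatrix n - G.transpose * G)) ↔ (screwMatrix n).PosDef

/-- RH-EQUIVALENT (do NOT book as progress): the FAMILY statement "every `S_M` has a manifest
certificate at some finite height".  `→ RH`: `manifestFamily_imp_rh`; `RH →`: the crux `TailDDOfRH`. -/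
def ManifestFamily (tmin : ℝ) : Prop := ∀ n : ℕ, ∃ T : ℝ, ManifestCert n tmin T

/-- RH-CONSEQUENCE, crux of the converse (open; mechanism [DERIVED, engine-B README §5 / T_expl]:
under RH, `S_M − Σ_{0<γ≤T} 2A_γ − 2τ(T)·J`, `τ(T) = Σ_{γ>T} γ⁻²`, has diagonal `≈ 2τ(T) ≈ log T/(πT)`
and, by Landau–Gonek, off-diagonal row sums `≈ (1/2πT)·(Σ_{d | m} Λ(d)d^{-1/2} + Σ_{k ≤ M/m} Λ(k)k^{-1/2})
= O(√M /T)`, so it is strictly DD once `log T ≳ C√M`: the truncated explicit formula is a manifest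
certificate beyond `T_expl(M) = exp(O(√M))` (census fit `52·2^{(M−8)/2}`, `M = 8…13`).  Atoms at the
ordinates (`≥ 14.13`) ⇒ any `t_min ≤ 14` works.  Why it might fail: the Landau–Gonek error terms must
be summed over `γ > T` with uniformity in `m, m' ≤ M`; a row whose off-diagonal mass is not captured by
prime-power ratios would break the `√M` count. [Gonek1993; Suzuki2023 Thm 1.1(2)] -/
def TailDDOfRH : Prop :=
  _root_.RiemannHypothesis → ∀ tmin : ℝ, tmin ≤ 14 → ManifestFamily tmin

/-- RH-FREE conjecture slot (an OBSTRUCTION law, true or false independently of RH; engine-B ddcone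
README §9 "what an analytic lower bound `T_DD(M) ≥ c·M` would take"): manifest certificates need
frequencies up to height `≥ c·M` — band-limited waves cannot resolve the `1/m`-spaced top nodes
(Nyquist).  Census: `T_DD(M)/M` from `2.6` (`M = 8`) to `3.9` (`M = 96`); no certificate was ever found
below `2.5·M`.  No constant is asserted here (`∃ c > 0`). -/
def NyquistFloor : Prop :=
  ∃ c : ℝ, 0 < c ∧ ∀ (n : ℕ) (tmin T : ℝ), 7 ≤ n → 0 < tmin → ManifestCert n tmin T → c * (n + 1) ≤ T

/-- RH-CONDITIONAL law slot (the census GROWTH law as an all-`M` sentence presupposes the family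
statement, i.e. RH): certificates exist by height `C·M·log M` (census: `T_DD(M) ∈ [0.86, 0.93]·M log M`
on `M = 40…96`, `≈ 3.73·M − 11.7` on `M ≤ 40`).  No constant asserted (`∃ C`). -/
def LinearithmicCeiling : Prop :=
  _root_.RiemannHypothesis →
    ∃ C : ℝ, ∀ n : ℕ, 7 ≤ n → ManifestCert n (1 / 10) (C * (n + 1) * Real.log (n + 1))

/-- RH-FREE finite DATA statement (one census BRACKET `T_DD(M) ∈ (lo, hi]`, `M = n + 1`, dictionary
`t ∈ [1/10, T]`): NO certificate at height `lo` (sos-dualcert/v1: a dual polynomial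
`Q_Y(t) = t²⟨A_t, Y⟩ ≥ 0` on `[1/10, lo]`, `⟨J, Y⟩ ≥ 0`, `⟨S_M, Y⟩ < 0`, interval-verified) AND a
certificate at height `hi` (sos-cert/v1, exact).  Kernel import of both sides = successor work
(shape: integer `G`, the tree's `uTable` enclosures of `S_M`, one DD check; dual: rational `Y` + a
Lipschitz grid bound). -/
def Rung (n : ℕ) (lo hi : ℝ) : Prop :=
  ¬ ManifestCert n (1 / 10) lo ∧ ManifestCert n (1 / 10) hi

/-- RH-FREE DATA of record, typed (ddcone/README §0, both ends certified, 73 certificates, M ≤ 40;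
gen3: M = 44).  `T_DD(M) ∈ (20,22], (30,35], (40,45], (45,50], (55,60], (60,65], (65,70], (75,80], (80,85],
(90,105], (100,105], (105,120], (120,125], (135,140], (155,160]` for
`M = 8,12,14,16,18,20,22,24,26,28,30,32,36,40,44`. -/
def CensusBracketsCertified : Prop :=
  Rung 7 20 22 ∧ Rung 11 30 35 ∧ Rung 13 40 45 ∧ Rung 15 45 50 ∧ Rung 17 55 60 ∧ Rung 19 60 65 ∧
  Rung 21 65 70 ∧ Rung 23 75 80 ∧ Rung 25 80 85 ∧ Rung 27 90 105 ∧ Rung 29 100 105 ∧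
  Rung 31 105 120 ∧ Rung 35 120 125 ∧ Rung 39 135 140 ∧ Rung 43 155 160

/-- RH-FREE DATA, typed, REF-PASSED by rh-columns-ref1 (g4/g5 (b)/g7 s-n1, 2026-08-25; both ends certified by
sos-eng-2 gen3/gen4, ddcone/DDCONE-ROWS.md; v1.2 adds `M = 112`, v1.5 adds `M = 48, 56, 64`): `T_DD(48) ∈ (170,175]`,
`T_DD(56) ∈ (200,205]`, `T_DD(64) ∈ (235,240]`, `T_DD(80) ∈ (305,310]`, `T_DD(96) ∈ (375,380]`, `T_DD(112) ∈ (440,445]`. -/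
def CensusBracketsRefPassed : Prop :=
  Rung 47 170 175 ∧ Rung 55 200 205 ∧ Rung 63 235 240 ∧ Rung 79 305 310 ∧ Rung 95 375 380 ∧ Rung 111 440 445

/-- RH-FREE DATA, typed; HISTORICAL (v1.1–v1.4 "provisional" slot).  Since rh-columns-ref1 g7 s-n1 (2026-08-25
18:32Z) BOTH rungs are REF-PASSED and are conjuncts of `CensusBracketsRefPassed` (v1.5); the def is kept verbatim
for the record: `T_DD(56) ∈ (200,205]`, `T_DD(64) ∈ (235,240]`.  (v1.1 listed 80/96 here; they are REF-PASSED,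
see `CensusBracketsRefPassed`.) -/
def CensusBracketsProvisional : Prop :=
  Rung 55 200 205 ∧ Rung 63 235 240


/-! ## Proofs of the RH-free linear-algebra items (no zeta input beyond `screwMatrix_isHermitian`) -/

section Proofs

open Finset

/-- `A_t = t⁻² • (c ⊗ c + s ⊗ s)`, `c = (1 − cos(t log m))_m`, `s = (sin(t log m))_m`. -/
theorem waveAtom_eq (n : ℕ) (t : ℝ) :
    waveAtom n t = (1 / t ^ 2) •
      (vecMulVec (fun i => 1 - Real.cos (t * node n i)) (star fun i => 1 - Real.cos (t * node n i))
        + vecMulVec (fun i => Real.sin (t * node n i)) (star fun i => Real.sin (t * node n i))) := by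
  ext i j
  simp only [waveAtom, Matrix.of_apply, Matrix.smul_apply, Matrix.add_apply, vecMulVec_apply,
    star_trivial, smul_eq_mul]
  rw [mul_sub, Real.cos_sub]
  ring

/-- The wave atom `A(t)` is positive semidefinite (a sum of two real rank-one Gram matrices). -/
theorem waveAtom_posSemidef (n : ℕ) (t : ℝ) : (waveAtom n t).PosSemidef := by
  rw [waveAtom_eq]
  exact ((posSemidef_vecMulVec_self_star _).add (posSemidef_vecMulVec_self_star _)).smul
    (by positivity)

/-- RH-FREE, PROVED. -/
theorem waveAtomPSD_proof : WaveAtomPSD := waveAtom_posSemidef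

/-- The all-ones matrix `J` is positive semidefinite. -/
theorem onesMat_posSemidef (n : ℕ) : (onesMat n).PosSemidef := by
  have h : onesMat n = vecMulVec (fun _ => (1 : ℝ)) (star fun _ => (1 : ℝ)) := by
    ext i j
    simp [onesMat, vecMulVec_apply]
  rw [h]
  exact posSemidef_vecMulVec_self_star _

/-- Swap of an off-diagonal double sum. -/
theorem offdiag_swap {n : ℕ} (h : Fin n → Fin n → ℝ) :
    ∑ i, ∑ j ∈ univ.erase i, h i j = ∑ j, ∑ i ∈ univ.erase j, h i j := by
  apply Finset.sum_comm'
  intro i j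
  simp only [mem_univ, mem_erase, true_and, and_true]
  exact ne_comm

/-- The diagonal-dominance lower bound of a real symmetric quadratic form:
`Σ_i x_i² (R_ii − Σ_{j≠i} |R_ij|) ≤ xᵀ R x`. -/
theorem quadForm_ge_ddMargin {n : ℕ} (R : Matrix (Fin n) (Fin n) ℝ) (hH : R.IsHermitian)
    (x : Fin n → ℝ) :
    ∑ i, x i ^ 2 * (R i i - ∑ j ∈ univ.erase i, |R i j|) ≤ x ⬝ᵥ (R *ᵥ x) := by
  have hsym : ∀ i j, R j i = R i j := fun i j => by simpa using hH.apply i j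
  have hq : x ⬝ᵥ (R *ᵥ x)
      = ∑ i, x i ^ 2 * R i i + ∑ i, ∑ j ∈ univ.erase i, R i j * (x i * x j) := by
    rw [← Finset.sum_add_distrib]
    simp only [dotProduct, mulVec]
    refine Finset.sum_congr rfl fun i _ => ?_
    rw [Finset.mul_sum, ← Finset.add_sum_erase _ _ (mem_univ i)]
    congr 1
    · ring
    · exact Finset.sum_congr rfl fun j _ => by ring
  have hL : ∑ i, x i ^ 2 * (R i i - ∑ j ∈ univ.erase i, |R i j|)
      = ∑ i, x i ^ 2 * R i i - ∑ i, ∑ j ∈ univ.erase i, |R i j| * x i ^ 2 := by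
    rw [← Finset.sum_sub_distrib]
    refine Finset.sum_congr rfl fun i _ => ?_
    rw [mul_sub, Finset.mul_sum]
    congr 1
    exact Finset.sum_congr rfl fun j _ => by ring
  have hswap : ∑ i, ∑ j ∈ univ.erase i, |R i j| * x j ^ 2
      = ∑ i, ∑ j ∈ univ.erase i, |R i j| * x i ^ 2 := by
    rw [offdiag_swap (fun i j => |R i j| * x j ^ 2)]
    refine Finset.sum_congr rfl fun j _ => Finset.sum_congr rfl fun i _ => ?_
    rw [hsym j i]
  have hnn : 0 ≤ ∑ i, ∑ j ∈ univ.erase i,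
      (R i j * (x i * x j) + |R i j| * x i ^ 2 / 2 + |R i j| * x j ^ 2 / 2) := by
    refine Finset.sum_nonneg fun i _ => Finset.sum_nonneg fun j _ => ?_
    have h1 : |x i * x j| ≤ (x i ^ 2 + x j ^ 2) / 2 := by
      rw [abs_le]
      constructor <;> nlinarith [sq_nonneg (x i - x j), sq_nonneg (x i + x j)]
    have h2 : -(|R i j| * |x i * x j|) ≤ R i j * (x i * x j) := by
      rw [← abs_mul]
      exact neg_abs_le _
    nlinarith [abs_nonneg (R i j)]
  have hsplit : ∑ i, ∑ j ∈ univ.erase i,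
      (R i j * (x i * x j) + |R i j| * x i ^ 2 / 2 + |R i j| * x j ^ 2 / 2)
      = ∑ i, ∑ j ∈ univ.erase i, R i j * (x i * x j)
        + (∑ i, ∑ j ∈ univ.erase i, |R i j| * x i ^ 2) / 2
        + (∑ i, ∑ j ∈ univ.erase i, |R i j| * x j ^ 2) / 2 := by
    simp only [Finset.sum_add_distrib, Finset.sum_div]
  rw [hswap] at hsplit
  rw [hL, hq]
  linarith [hnn, hsplit]

/-- RH-FREE, PROVED: a Hermitian strictly diagonally dominant real matrix is positive definite. -/
theorem strictDDPosDef_proof : StrictDDPosDef := by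
  intro n R hH hdd
  refine Matrix.PosDef.of_dotProduct_mulVec_pos hH fun x hx => ?_
  rw [star_trivial]
  refine lt_of_lt_of_le ?_ (quadForm_ge_ddMargin R hH x)
  obtain ⟨i, hi⟩ := Function.ne_iff.mp hx
  have hi' : x i ≠ 0 := by simpa using hi
  apply Finset.sum_pos'
  · intro j _
    exact mul_nonneg (sq_nonneg _) (sub_nonneg.mpr (le_of_lt (hdd j)))
  · exact ⟨i, mem_univ i, mul_pos (by positivity) (sub_pos.mpr (hdd i))⟩

/-- The PSD part of a wave decomposition. -/
theorem wavePart_posSemidef (n K : ℕ) (t w : Fin K → ℝ) (wJ : ℝ) (hw : ∀ k, 0 ≤ w k)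
    (hwJ : 0 ≤ wJ) : ((∑ k, w k • waveAtom n (t k)) + wJ • onesMat n).PosSemidef := by
  refine Matrix.PosSemidef.add ?_ ((onesMat_posSemidef n).smul hwJ)
  exact posSemidef_sum univ fun k _ => (waveAtom_posSemidef n (t k)).smul (hw k)

/-- RH-FREE, PROVED: SOUNDNESS of the typed format. -/
theorem manifestCertSound_proof : ManifestCertSound := by
  intro n tmin T h
  obtain ⟨K, t, w, wJ, hk, hwJ, hR⟩ := h
  have hP := wavePart_posSemidef n K t w wJ (fun k => (hk k).2.2.2) hwJ
  have hdecomp : screwMatrix n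
      = remainder n K t w wJ + ((∑ k, w k • waveAtom n (t k)) + wJ • onesMat n) := by
    simp only [remainder]
    abel
  have hRH : (remainder n K t w wJ).IsHermitian := by
    have h1 : remainder n K t w wJ
        = screwMatrix n - ((∑ k, w k • waveAtom n (t k)) + wJ • onesMat n) := by
      simp only [remainder]
      abel
    rw [h1]
    exact (screwMatrix_isHermitian n).sub hP.isHermitian
  rw [hdecomp]
  exact (strictDDPosDef_proof n _ hRH hR).add_posSemidef hP

/-- RH-FREE, PROVED: each census cell is an honest finite positivity statement — a certificate at any
height gives `S_{n+1} ≻ 0` (so a kernel-imported `Rung n lo hi` re-proves the tree's rung at `n`). -/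
theorem posDef_of_rung {n : ℕ} {lo hi : ℝ} (h : Rung n lo hi) : (screwMatrix n).PosDef :=
  manifestCertSound_proof n _ _ h.2

end Proofs

end Summit.RiemannHypothesis.RiemannHypothesis.Theorems.IntegerScrew.Manifest
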